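import Summits.QuantumFields.YangMills.Theorems.LuscherReductionTwistedTraceScalingBORecordInputOfST
import Summits.QuantumFields.YangMills.Theorems.LuscherReductionTwistedTraceScalingBOStiffColour
import HarnessLib

/-!
# (B-ST) central-fibre objects (route-posited abbreviations for the fibre block of the hST assembly)
# (lane A of S-BASE, crux `TwistedTraceScaling` stmt-QuantumFields-20203, C4-CORE, the (B-ST) pen; HANDOFF-g21 STUB LEDGER (L-3), spec `g21-FibreBlock-spec.lean`)

The fibre block of `…BOStiffSlowAssembly.form_le_of_product_near` lives at the central slow datum `u = 1` on `X = Bal` with `π = orthoTransverse L`.  This file only NAMES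
the objects every (L-3) statement repeats (no claims): the central based kernel `cM`, the central weight `cW`, the hST profile `cΩ` (cap-restricted frozen profile, exactly
the `Ω` of `…BORecordInputOfST.recordAnalyticInput_of_hST`) and its fibre version `cΘ = cΩ ∘ linkEmbed`, the support `cS = {cΘ ≠ 0}`, and the profile's Rayleigh quotient `cΛ`.
HONEST FRAMING: definitions for a stub of a child of the CONDITIONAL route R2b1; (B-ST) OPEN; C4-CORE OPEN; not infinite volume, not a gap, not Clay.
-/

set_option autoImplicit false

noncomputable section

open MeasureTheory

namespace Summit.QuantumFields.YangMills.Theorems.FemtoTransferGap.TwoLattice.ConstTube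

open Literature.MathematicalPhysics.QuantumFieldTheory Literature.MathematicalPhysics.QuantumLattice TwoLattice.Avg TwoLattice.Stiff TwoLattice.GnChart TwoLattice.Cov

variable (L : ℕ) [NeZero L]

/-- The **central based kernel** `cM β x x' = ∫ K_β(orthoTube 1 x, (orthoTube 1 x')^{basedExt h}) dh` — the `M` of the fibre block. [cite: Luscher1983, §3] -/
def cM (β : ℝ) (x x' : Edge 3 L → Fin 3 → ℝ) : ℝ :=
  ∫ h, transferKernel su2Rep β (orthoTube L 1 x) (gaugeTransform (basedExt L h) (orthoTube L 1 x')) ∂basedMeasure L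

/-- The **central weight** `cW s M β x = softWeight (recordChi L s 43 M β) (orthoTube 1 x)` (`= gaugeAvg χ / χ` at the central tube point). [cite: SeilerLNP1982, §2] -/
def cW (s M β : ℝ) (x : Edge 3 L → Fin 3 → ℝ) : ℝ := softWeight (recordChi L s 43 M β) (orthoTube L 1 x)

/-- The **hST profile** `Ω_c`: the cap-restricted frozen profile `𝟙[linkCurry y ∈ Bal]·frozenProfile(stiffGaussExp(β/2), min(1/40, β^{-1/2} btLog β)) β y` — literally the
`Ω` of `recordAnalyticInput_of_hST`. [cite: Luscher1983, §3] -/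
def cΩ (β : ℝ) (y : LinkSpace L) : ℝ :=
  {y : LinkSpace L | linkCurry y ∈ capBalancedSet L}.indicator (fun _ => (1 : ℝ)) y *
    frozenProfile L (fun β' => stiffGaussExp L (β' / 2) β') (fun β' => min (1 / 40) (powScale (1 / 2) β' * btLog β')) β y

/-- The profile on the fibre: `cΘ β x = cΩ β (linkEmbed x)` — the `Θ` of the fibre block. [cite: Luscher1983, §3] -/
def cΘ (β : ℝ) (x : Edge 3 L → Fin 3 → ℝ) : ℝ := cΩ L β (linkEmbed L x)

/-- Its support `cS β = {x | cΘ β x ≠ 0}` — the `S` of the fibre block (a closed ball in the balanced cap; `cΘ` is floored, not tapered, on it). [folklore] -/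
def cS (β : ℝ) : Set (Edge 3 L → Fin 3 → ℝ) := {x | cΘ L β x ≠ 0}

/-- The profile's **Rayleigh quotient** `cΛ = ∫∫ cΘ·cM·cΘ dπ dπ / ∫ cΘ²·cW dπ` — the fibre level `Λ` of the fibre block. [cite: Luscher1983, §3] -/
def cΛ (s M β : ℝ) : ℝ :=
  (∫ x, ∫ y, cΘ L β x * cM L β x y * cΘ L β y ∂orthoTransverse L ∂orthoTransverse L) / ∫ x, cΘ L β x ^ 2 * cW L s M β x ∂orthoTransverse L

end Summit.QuantumFields.YangMills.Theorems.FemtoTransferGap.TwoLattice.ConstTube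

end
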